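import Summits.Langlands.Langlands.Theorems.SqrtFiveQuarticCoversBorelThreeHauptmodul
import Summits.Langlands.Langlands.Theorems.SqrtFiveQuarticCoversSplitCartanThreeDivisionPolynomial

/-!
# Route `SqrtFiveQuarticCovers`, crux `BoxBorelFive` (stmt-Langlands-17835): the level-`3` binder
# `b3 ∨ s3` read as modular-curve data (`X₀(3)`-hauptmodul or `X_s⁺(3)` quadratic factor)

The cruxes `BoxBorelFive` (stmt-Langlands-17835), `RefinedLocusModular` (17833) and the conclusion of
`ReductionToRefinedLocus` (17834) carry the SAME written-out level-`3` binder: a framing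
`ρ̄ : Γ_K →ₜ* GL₂(𝔽₃)` of `E[3]` (equivariant `e : E[3](K̄) ≃+ 𝔽₃²`) whose image is upper triangular
(`b3`) OR lies in `C_s⁺(3) = ⟨diag(1,2), antidiag(1,1)⟩` (`s3`).  This file assembles the three landed
bricks (p798920 `…BorelThreeDivisionPolynomial`, p799099 `…BorelThreeHauptmodul`,
p799791 `…SplitCartanThreeDivisionPolynomial`) into ONE statement on that binder VERBATIM:

* `levelThree_moduli_of_framing` — for `E / 𝓞 K` over a number field with `Δ(E) ≠ 0` and the
  `b3 ∨ s3` binder: EITHER there is `t ∈ K`, `t ≠ 0`, with `c₄(E⊗K)³ · t = (t+27)(t+3)³ · Δ(E⊗K)`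
  (`j(E) ∈ j(X₀(3)(K))`, Fricke's hauptmodul), OR `Ψ₃(E⊗K)` has two distinct roots in `K̄` with sum and
  product in `K` (a `K`-rational quadratic factor: the moduli meaning of a `K`-point of `X_s⁺(3)`).

Proved, no named fact.  HONEST STATUS: helper of stmt-Langlands-17835 (its hypothesis `h3` is exactly this
binder); the crux itself stays conditional on `Box2022_theorem1_5_modular`
(`Theorems/SqrtFiveQuarticCoversBoxBorelFive.lean`); nothing here proves modularity of any curve.

References: J. H. Silverman, *The Arithmetic of Elliptic Curves*, GTM 106 (2009), III.§7, Ex. 3.7;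
[Box2022] §1.1 (moduli interpretation `Im ρ̄_{E,N} ⊆ G ⇒ Y_G(K)`-point); [FreitasLeHungSiksek2015] §2.2.
-/

noncomputable section

set_option linter.dupNamespace false -- project-wide option (lakefile weak.linter.dupNamespace); `Summit.Langlands.Langlands` is the mandated namespace

open scoped Classical
open scoped Matrix NumberField

namespace Summit.Langlands.Langlands.Theorems.SqrtFiveQuarticCovers

open WeierstrassCurve Literature.NumberTheory.GaloisRepresentations Polynomial

/-- **The level-`3` binder of the route's cruxes as modular-curve data.**  For a number field `K`,
`E / 𝓞 K` with `Δ(E) ≠ 0`, and a framing `ρ̄` of `E[3]` which is Borel (`b3`) or lands in `C_s⁺(3)`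
(`s3`) — the binder of `BoxBorelFive` / `RefinedLocusModular` VERBATIM — either
`∃ t ∈ K, t ≠ 0, c₄³ · t = (t+27)(t+3)³ · Δ` (a `K`-point of `X₀(3)` over `j(E)`), or `Ψ₃(E⊗K)` has two
distinct `K̄`-roots with sum and product in `K` (a `K`-rational quadratic factor, i.e. a `K`-point of
`X_s⁺(3)` over `j(E)`).  Proof: `exists_X0_three_hauptmodul_of_borelThree_framing` (p799099) in the
first case, `exists_pair_roots_Ψ₃_of_splitCartanThree_framing` (p799791) in the second.
[cite: SilvermanAEC2009, III.§7, Ex. 3.7] [cite: Box2022, §1.1] -/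
theorem levelThree_moduli_of_framing (K : Type) [Field K] [NumberField K]
    (E : WeierstrassCurve (𝓞 K)) (hE : E.Δ ≠ 0)
    (h3 : ∃ ρ : Literature.NumberTheory.GaloisRepresentations.FramedGaloisRep K (ZMod 3) 2,
      (∃ e : (E.baseChange K).geomTorsion ((3 : ℕ) : ℤ) ≃+ (Fin 2 → ZMod 3),
        ∀ (σ : Field.absoluteGaloisGroup K) (P : (E.baseChange K).geomTorsion ((3 : ℕ) : ℤ)),
          e (σ • P) = ((ρ σ : GL (Fin 2) (ZMod 3)) : Matrix (Fin 2) (Fin 2) (ZMod 3)) *ᵥ (e P)) ∧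
      ((∀ σ : Field.absoluteGaloisGroup K,
          (((ρ σ : GL (Fin 2) (ZMod 3)) : Matrix (Fin 2) (Fin 2) (ZMod 3)) 1 0 = 0)) ∨
        (∀ σ : Field.absoluteGaloisGroup K, (ρ σ : GL (Fin 2) (ZMod 3)) ∈ Subgroup.closure
          ({(⟨!![1, 0; 0, 2], !![1, 0; 0, 2], by decide, by decide⟩ : GL (Fin 2) (ZMod 3)),
            (⟨!![0, 1; 1, 0], !![0, 1; 1, 0], by decide, by decide⟩ : GL (Fin 2) (ZMod 3))} :
            Set (GL (Fin 2) (ZMod 3)))))) :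
    (∃ t : K, t ≠ 0 ∧ (E.baseChange K).c₄ ^ 3 * t = (t + 27) * (t + 3) ^ 3 * (E.baseChange K).Δ) ∨
    (∃ x₁ x₂ : AlgebraicClosure K, x₁ ≠ x₂ ∧
      ((E.baseChange K).baseChange (AlgebraicClosure K)).Ψ₃.eval x₁ = 0 ∧
      ((E.baseChange K).baseChange (AlgebraicClosure K)).Ψ₃.eval x₂ = 0 ∧
      x₁ + x₂ ∈ Set.range (algebraMap K (AlgebraicClosure K)) ∧
      x₁ * x₂ ∈ Set.range (algebraMap K (AlgebraicClosure K))) := by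
  obtain ⟨ρ, he, hB | hS⟩ := h3
  · exact Or.inl (exists_X0_three_hauptmodul_of_borelThree_framing K E hE ⟨ρ, he, hB⟩)
  · exact Or.inr (exists_pair_roots_Ψ₃_of_splitCartanThree_framing K E ⟨ρ, he, hS⟩)

end Summit.Langlands.Langlands.Theorems.SqrtFiveQuarticCovers

end
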